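import Mathlib
import Literature.Computability.AlgebraicComplexity.DeterminantalIdealComplexityProofs
import Summits.MatrixMultiplication.MatrixMultiplication.Theses.HiddenToeplitzCorners
import Summits.MatrixMultiplication.MatrixMultiplication.Theses.DeterminantalIdealExponent

/-!
# `HiddenToeplitzCorners.CheapIdealMembers` — the glue target is the summit in another currency

Item `stmt-MatrixMultiplication-7497` (support of route `HiddenToeplitzCorners`):
`CheapIdealMembers : ∀ ε > 0, ∃ᶠ r, ∃ f ≠ 0, det X_r ∣ f ∧ complexity f ≤ r^(2+ε)` — "the
determinantal ideal `(det_r)` has nonzero members of essentially quadratic division-free circuit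
size, infinitely often".

This file does NOT settle the item (it is an open problem, see below); it records, sorry-free, the
three facts that locate it exactly:

* `cheapIdealMembers_iff_cheapIdealMember` — the item is the SAME proposition as the target `X` of
  the companion route, `DeterminantalIdealExponent.CheapIdealMember` (item
  `stmt-MatrixMultiplication-7708`: `∃ g ≠ 0, complexity (g · det_r) ≤ r^(2+ε)`), by
  `det_r ∣ f ↔ f = g · det_r` in the domain `ℂ[X]` (`detPoly (Fin r) ℂ = det (mvPolynomialX …)` by
  `rfl`, `Matrix.det_mvPolynomialX_ne_zero`). Whichever of the two items is settled, the other
  follows in one line.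
* `matrixMultiplication_of_cheapIdealMembers` — the item IMPLIES the summit `ω(ℂ) = 2`,
  UNCONDITIONALLY: Andrews' lifting theorem is proved in the tree
  (`Andrews2022_thm3_holds`, arXiv:2208.01078 Thm. 3), which discharges the companion route's crux
  `AndrewsLifting` (`Andrews2022_thm3.andrewsLifting`), and that route's deciding theorem
  `DeterminantalIdealExponent.closes` (Bini bookkeeping, proved in its route file) does the rest.
  So a proof of this "support" item is a proof of the summit.
* `cheapIdealMembers_of_fastDetMultiple` — conversely, modulo the companion route's calibration
  support `FastDetMultiple` (item `stmt-MatrixMultiplication-7713`: some nonzero multiple of `det_r`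
  has division-free circuits of size `C_ε · r^(ω+ε)`; Strassen 1973 numerator/denominator pairs on
  top of `ω`-fast elimination), `ω(ℂ) = 2` gives the item back; so, given that support, the item
  is EQUIVALENT to the summit ("the ideal `(det_r)` knows `ω`").

Consequently neither `CheapIdealMembers` nor its negation (which would be a superquadratic size
lower bound for every nonzero member of `(det_r)`, the companion route's open crux
`HittingThreshold`) is provable with what is known; inside route `HiddenToeplitzCorners` the item is
obtained only as `CostGlue hT hH` from the two cruxes, exactly as `closes` already does internally.
-/

-- `Summit.<Summit>.<Problem>` is the tree's mandated summit-side namespace; for this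
-- single-conjunct summit the two coincide, so the file silences `dupNamespace`.
set_option linter.dupNamespace false

namespace Summit.MatrixMultiplication.MatrixMultiplication.Theorems

open Literature.Computability.AlgebraicComplexity

/-- Pointwise (fixed `r`, fixed budget `B`) form of the twin equivalence: a nonzero `f` with
`det X_r ∣ f` and `complexity f ≤ B` exists iff a nonzero cofactor `g` with
`complexity (g · det_r) ≤ B` exists (`f = det_r · g`; `ℂ[X]` is a domain and `det_r ≠ 0`). -/
theorem exists_det_dvd_complexity_le_iff (r : ℕ) (B : ℝ) :
    (∃ f : MvPolynomial (Fin r × Fin r) ℂ, f ≠ 0 ∧ (Matrix.mvPolynomialX (Fin r) (Fin r) ℂ).det ∣ f ∧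
        (complexity f : ℝ) ≤ B) ↔
      ∃ g : MvPolynomial (Fin r × Fin r) ℂ, g ≠ 0 ∧ (complexity (g * detPoly (Fin r) ℂ) : ℝ) ≤ B := by
  constructor
  · rintro ⟨f, hf, ⟨g, rfl⟩, hc⟩
    refine ⟨g, ?_, ?_⟩
    · rintro rfl
      exact hf (mul_zero _)
    · rwa [detPoly, mul_comm]
  · rintro ⟨g, hg, hc⟩
    refine ⟨g * detPoly (Fin r) ℂ, ?_, ⟨g, ?_⟩, hc⟩
    · exact mul_ne_zero hg (by simpa [detPoly] using Matrix.det_mvPolynomialX_ne_zero (Fin r) ℂ)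
    · rw [detPoly, mul_comm]

/-- **Twin equivalence.** Item `stmt-MatrixMultiplication-7497` (`HiddenToeplitzCorners.CheapIdealMembers`)
and the companion route's target `stmt-MatrixMultiplication-7708`
(`DeterminantalIdealExponent.CheapIdealMember`) are the same proposition. -/
theorem cheapIdealMembers_iff_cheapIdealMember :
    Summit.MatrixMultiplication.MatrixMultiplication.Theses.HiddenToeplitzCorners.CheapIdealMembers ↔
      Summit.MatrixMultiplication.MatrixMultiplication.Theses.DeterminantalIdealExponent.CheapIdealMember := by
  unfold Theses.HiddenToeplitzCorners.CheapIdealMembers Theses.DeterminantalIdealExponent.CheapIdealMember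
  exact ⟨fun h ε hε => (h ε hε).mono fun r hr => (exists_det_dvd_complexity_le_iff r _).mp hr,
    fun h ε hε => (h ε hε).mono fun r hr => (exists_det_dvd_complexity_le_iff r _).mpr hr⟩

/-- **The item implies the summit, unconditionally.** `CheapIdealMembers → ω(ℂ) = 2`: the twin
equivalence, Andrews' lifting theorem PROVED in the tree (`Andrews2022_thm3_holds`, giving the
companion crux `AndrewsLifting` via `Andrews2022_thm3.andrewsLifting`), and the companion route's
proved deciding theorem `DeterminantalIdealExponent.closes` (Bini's theorem `Blaser2013_thm66_holds`
+ `omega_two_le`). -/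
theorem matrixMultiplication_of_cheapIdealMembers
    (h : Summit.MatrixMultiplication.MatrixMultiplication.Theses.HiddenToeplitzCorners.CheapIdealMembers) :
    _root_.MatrixMultiplication :=
  Theses.DeterminantalIdealExponent.closes
    (fun r g hg => Andrews2022_thm3_holds.andrewsLifting r g hg)
    (cheapIdealMembers_iff_cheapIdealMember.mp h)

/-- **Converse modulo the calibration support `FastDetMultiple`** (item `stmt-MatrixMultiplication-7713`
of the companion route: `∀ ε > 0, ∃ C, ∀ r ≥ 1, ∃ g ≠ 0, complexity (g · det_r) ≤ C · r^(ω(ℂ)+ε)`):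
if `ω(ℂ) = 2` then, at `ε/2`, `C · r^(2+ε/2) ≤ r^(2+ε)` as soon as `r^(ε/2) ≥ C`, so cheap members
exist for ALL large `r` (in particular frequently). -/
theorem cheapIdealMembers_of_fastDetMultiple
    (hF : Summit.MatrixMultiplication.MatrixMultiplication.Theses.DeterminantalIdealExponent.FastDetMultiple)
    (hω : _root_.MatrixMultiplication) :
    Summit.MatrixMultiplication.MatrixMultiplication.Theses.HiddenToeplitzCorners.CheapIdealMembers := by
  rw [cheapIdealMembers_iff_cheapIdealMember]
  intro ε hε
  rw [MatrixMultiplication_iff] at hω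
  have hε2 : (0 : ℝ) < ε / 2 := half_pos hε
  obtain ⟨C, hC⟩ := hF (ε / 2) hε2
  have hev : ∀ᶠ r : ℕ in Filter.atTop, C ≤ (r : ℝ) ^ (ε / 2) :=
    ((tendsto_rpow_atTop hε2).comp tendsto_natCast_atTop_atTop).eventually_ge_atTop C
  refine ((hev.and (Filter.eventually_ge_atTop 1)).mono fun r hr => ?_).frequently
  obtain ⟨hrC, hr1⟩ := hr
  obtain ⟨g, hg, hc⟩ := hC r hr1
  refine ⟨g, hg, hc.trans ?_⟩
  have hr0 : (0 : ℝ) < (r : ℝ) := by exact_mod_cast hr1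
  rw [hω]
  calc C * (r : ℝ) ^ (2 + ε / 2) ≤ (r : ℝ) ^ (ε / 2) * (r : ℝ) ^ (2 + ε / 2) :=
        mul_le_mul_of_nonneg_right hrC (Real.rpow_nonneg hr0.le _)
    _ = (r : ℝ) ^ (2 + ε) := by
        rw [← Real.rpow_add hr0]
        congr 1
        ring

/-! ### The negative side located: refuting the item is the companion crux `HittingThreshold`

Appended 2026-08-16 (item `stmt-MatrixMultiplication-7497`, second prover pass). The two theorems
below finish the bookkeeping of where the item sits: its NEGATION is literally the companion
route's open negative-side crux `DeterminantalIdealExponent.HittingThreshold` (item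
`stmt-MatrixMultiplication-7710`, "equivalent to `ω(ℂ) > 2`"), so items 7497 and 7710 are
complementary — exactly one of them is true, and settling either settles both; and, given the
calibration support `FastDetMultiple`, the item is equivalent to the summit. -/

/-- **Negation of the item = `HittingThreshold`.** `¬ CheapIdealMembers` says: for some `ε > 0`,
for all large `r`, every nonzero multiple of `det X_r` has `complexity > r^(2+ε)`; this is the
companion route's crux `HittingThreshold` (`∃ δ > 0, ∀ᶠ r, ∀ g ≠ 0, r^(2+δ) ≤ complexity (g · det_r)`):
`→` with `δ := ε` and `f := g · det_r`; `←` with `ε := δ/2`, since `r^(2+δ/2) < r^(2+δ)` for `r ≥ 2`. -/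
theorem not_cheapIdealMembers_iff_hittingThreshold :
    ¬ Summit.MatrixMultiplication.MatrixMultiplication.Theses.HiddenToeplitzCorners.CheapIdealMembers ↔
      Summit.MatrixMultiplication.MatrixMultiplication.Theses.DeterminantalIdealExponent.HittingThreshold := by
  rw [cheapIdealMembers_iff_cheapIdealMember]
  unfold Theses.DeterminantalIdealExponent.CheapIdealMember
    Theses.DeterminantalIdealExponent.HittingThreshold
  constructor
  · intro h
    simp only [not_forall] at h
    obtain ⟨ε, hε, hfreq⟩ := h
    refine ⟨ε, hε, ?_⟩
    rw [Filter.not_frequently] at hfreq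
    filter_upwards [hfreq] with r hr g hg
    by_contra hlt
    exact hr ⟨g, hg, (not_le.mp hlt).le⟩
  · rintro ⟨δ, hδ, hev⟩ h
    have hδ2 : (0 : ℝ) < δ / 2 := half_pos hδ
    obtain ⟨r, ⟨g, hg, hc⟩, hr, hr2⟩ :=
      ((h (δ / 2) hδ2).and_eventually (hev.and (Filter.eventually_ge_atTop 2))).exists
    have hr1 : (1 : ℝ) < (r : ℝ) := by exact_mod_cast (hr2 : 2 ≤ r)
    have hlt : (r : ℝ) ^ (2 + δ / 2) < (r : ℝ) ^ (2 + δ) :=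
      Real.rpow_lt_rpow_of_exponent_lt hr1 (by linarith)
    exact absurd ((hr g hg).trans hc) (not_le.mpr hlt)

/-- **Dichotomy of the twin items.** Exactly one of `CheapIdealMembers` (item 7497 = companion
target 7708) and `HittingThreshold` (companion crux 7710) holds. -/
theorem cheapIdealMembers_xor_hittingThreshold :
    Xor Summit.MatrixMultiplication.MatrixMultiplication.Theses.HiddenToeplitzCorners.CheapIdealMembers
      Summit.MatrixMultiplication.MatrixMultiplication.Theses.DeterminantalIdealExponent.HittingThreshold := by
  rw [← not_cheapIdealMembers_iff_hittingThreshold]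
  by_cases h :
      Summit.MatrixMultiplication.MatrixMultiplication.Theses.HiddenToeplitzCorners.CheapIdealMembers
  · exact Or.inl ⟨h, fun hn => hn h⟩
  · exact Or.inr ⟨h, h⟩

/-- **The item is the summit, given the calibration support.** Modulo the companion route's
support `FastDetMultiple` (item `stmt-MatrixMultiplication-7713`, in print: `ω`-fast block
elimination with pseudo-adjugates, division-free), `CheapIdealMembers ↔ ω(ℂ) = 2`; the forward
direction is unconditional (`matrixMultiplication_of_cheapIdealMembers`). -/
theorem cheapIdealMembers_iff_matrixMultiplication
    (hF : Summit.MatrixMultiplication.MatrixMultiplication.Theses.DeterminantalIdealExponent.FastDetMultiple) :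
    Summit.MatrixMultiplication.MatrixMultiplication.Theses.HiddenToeplitzCorners.CheapIdealMembers ↔
      _root_.MatrixMultiplication :=
  ⟨matrixMultiplication_of_cheapIdealMembers, cheapIdealMembers_of_fastDetMultiple hF⟩

/-- **… and so is the negation of the companion crux.** Modulo `FastDetMultiple`,
`HittingThreshold ↔ ω(ℂ) ≠ 2` (i.e. `ω(ℂ) > 2`, as `2 ≤ ω` always). -/
theorem hittingThreshold_iff_not_matrixMultiplication
    (hF : Summit.MatrixMultiplication.MatrixMultiplication.Theses.DeterminantalIdealExponent.FastDetMultiple) :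
    Summit.MatrixMultiplication.MatrixMultiplication.Theses.DeterminantalIdealExponent.HittingThreshold ↔
      ¬ _root_.MatrixMultiplication := by
  rw [← not_cheapIdealMembers_iff_hittingThreshold, cheapIdealMembers_iff_matrixMultiplication hF]

end Summit.MatrixMultiplication.MatrixMultiplication.Theorems
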